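import Mathlib.Analysis.Complex.CauchyIntegral
import Mathlib.Analysis.Analytic.Order
import HarnessLib

/-!
# Cauchy's integral formula for derivatives at an off-centre point

`Literature/Analysis/Complex/OffCentreCauchyFormula.lean`. Mathlib (rev. 2026) proves Cauchy's
integral formula for the `n`-th derivative only at the CENTRE of the circle
(`Complex.circleIntegral_one_div_sub_center_pow_smul_of_differentiable_on_off_countable`,
`DiffContOnCl.circleIntegral_one_div_sub_center_pow_smul`; the off-centre version is an explicit
`TODO` in `Mathlib/Analysis/Complex/CauchyIntegral.lean`), and the first-order formula at an
arbitrary interior point (`DiffContOnCl.circleIntegral_sub_inv_smul`). This file supplies the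
general statement for scalar functions:

* `circleIntegral_div_sub_pow_eq_iteratedDeriv`: if `f` is holomorphic on an open set containing the
  closed disc `|z − c| ≤ R` and `|w − c| < R`, then
  `∮_{|z−c|=R} f(z) (z − w)^{−(n+1)} dz = (2πi/n!) f^{(n)}(w)`.

Proof: Taylor's formula at `w` with an analytic remainder
(`AnalyticAt.exists_eq_sum_add_pow_mul`: `f = ∑_{i ≤ n} f^{(i)}(w)(z − w)^i/i! + (z − w)^{n+1} g`),
Cauchy–Goursat for the remainder `g` (`DiffContOnCl.circleIntegral_eq_zero`), and the model
integrals `∮ (z − w)^m dz = 0` (`m ≠ −1`), `∮ (z − w)^{−1} dz = 2πi`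
(`circleIntegral.integral_sub_zpow_of_ne`, `circleIntegral.integral_sub_inv_of_mem_ball`).
Used in `Literature/Barriers/Schanuel/` (Nesterenko's interpolation lemma, LNM 1752 Ch. 3 Lemma 3.3).
Classical (Ahlfors, *Complex Analysis*, 3rd ed., Ch. 4 §2.3 (25)); tagged `[folklore]`.
-/

noncomputable section

open Complex Filter Topology Metric Finset
open scoped Real

namespace Literature.Analysis.Complex

/-- **Cauchy's integral formula for derivatives at an off-centre point** (the `w ∈ ball c R` version
left as a TODO in Mathlib's `CauchyIntegral.lean`): if `f` is holomorphic on an open set containing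
the closed disc `|z − c| ≤ R` and `|w − c| < R`, then
`∮_{|z−c|=R} f(z) (z − w)^{−(n+1)} dz = (2πi/n!) f^{(n)}(w)`. Proof: Taylor's formula at `w` with an
analytic remainder `f = ∑_{i ≤ n} f^{(i)}(w) (z − w)^i/i! + (z − w)^{n+1} g`, Cauchy–Goursat for `g`, and
`∮ (z − w)^m dz = 0` (`m ≠ −1`), `= 2πi` (`m = −1`). [folklore] -/
theorem circleIntegral_div_sub_pow_eq_iteratedDeriv {U : Set ℂ} (hU : IsOpen U) {f : ℂ → ℂ}
    (hf : DifferentiableOn ℂ f U) {c w : ℂ} {R : ℝ} (hRU : closedBall c R ⊆ U) (hw : w ∈ ball c R)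
    (n : ℕ) :
    (∮ z in C(c, R), f z / (z - w) ^ (n + 1)) =
      2 * π * I / n.factorial * iteratedDeriv n f w := by
  have hR0 : 0 < R := dist_nonneg.trans_lt hw
  have hwU : U ∈ 𝓝 w := hU.mem_nhds (hRU (ball_subset_closedBall hw))
  -- Taylor's formula at `w` of order `n + 1` with analytic remainder (shifted to the origin)
  have han : AnalyticAt ℂ (fun z => f (z + w)) 0 := by
    have h1 : AnalyticAt ℂ f w := hf.analyticAt hwU
    have h3 : AnalyticAt ℂ (fun z : ℂ => z + w) 0 := by fun_prop
    have h4 : AnalyticAt ℂ (f ∘ fun z : ℂ => z + w) 0 := h1.comp_of_eq h3 (by simp)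
    simpa [Function.comp_def] using h4
  obtain ⟨g, hg0, hgid⟩ := han.exists_eq_sum_add_pow_mul (n + 1)
  set g₁ : ℂ → ℂ := fun z => g (z - w) with hg₁
  set P : ℂ → ℂ := fun z => ∑ i ∈ Finset.range (n + 1),
    (z - w) ^ i / (i.factorial : ℂ) * iteratedDeriv i f w with hP
  have hid : ∀ z, f z = P z + (z - w) ^ (n + 1) * g₁ z := by
    intro z
    have h := hgid (z - w)
    simp only [sub_add_cancel, iteratedDeriv_comp_add_const, zero_add, smul_eq_mul] at h
    simpa [hP, hg₁] using h
  -- the remainder `g₁` is holomorphic on `U`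
  have hg₁U : DifferentiableOn ℂ g₁ U := by
    intro z hz
    rcases eq_or_ne z w with rfl | hzw
    · have : AnalyticAt ℂ g₁ z := by
        have h3 : AnalyticAt ℂ (fun y : ℂ => y - z) z := by fun_prop
        have h4 : AnalyticAt ℂ (g ∘ fun y : ℂ => y - z) z := hg0.comp_of_eq h3 (by simp)
        simpa [hg₁, Function.comp_def] using h4
      exact this.differentiableAt.differentiableWithinAt
    · have hPd : Differentiable ℂ P := by
        simp only [hP]
        fun_prop
      have hev : g₁ =ᶠ[𝓝 z] fun y => (f y - P y) / (y - w) ^ (n + 1) := by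
        filter_upwards [isOpen_ne.mem_nhds hzw] with y hy
        have hy' : (y - w) ^ (n + 1) ≠ 0 := pow_ne_zero _ (sub_ne_zero.mpr hy)
        rw [eq_div_iff hy', hid y]
        ring
      refine (DifferentiableAt.congr_of_eventuallyEq ?_ hev).differentiableWithinAt
      have hfz : DifferentiableAt ℂ f z := hf.differentiableAt (hU.mem_nhds hz)
      exact (hfz.sub (hPd z)).div (((differentiableAt_id).sub_const w).pow _)
        (pow_ne_zero _ (sub_ne_zero.mpr hzw))
  have hg₁c : DiffContOnCl ℂ g₁ (ball c R) :=
    (hg₁U.mono ((closure_ball_subset_closedBall).trans hRU)).diffContOnCl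
  -- integrate termwise
  have hwns : w ∉ sphere c |R| := by
    rw [abs_of_pos hR0]
    intro h
    rw [mem_sphere] at h
    rw [mem_ball] at hw
    exact (lt_irrefl _) (h ▸ hw)
  have hsph : ∀ z ∈ sphere c R, z - w ≠ 0 := by
    intro z hz h
    rw [sub_eq_zero] at h
    subst h
    exact hwns (by rwa [abs_of_pos hR0])
  have hcongr : Set.EqOn (fun z => f z / (z - w) ^ (n + 1))
      (fun z => (∑ i ∈ Finset.range (n + 1),
        iteratedDeriv i f w / (i.factorial : ℂ) * (z - w) ^ ((i : ℤ) - (n + 1 : ℕ))) + g₁ z)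
      (sphere c R) := by
    intro z hz
    have hzw := hsph z hz
    simp only
    rw [hid z, hP, add_div, Finset.sum_div, mul_div_cancel_left₀ _ (pow_ne_zero _ hzw)]
    congr 1
    refine Finset.sum_congr rfl fun i _ => ?_
    rw [zpow_sub₀ hzw, zpow_natCast, zpow_natCast]
    field_simp
  rw [circleIntegral.integral_congr hR0.le hcongr]
  have hcont_pow : ∀ i ∈ Finset.range (n + 1), ContinuousOn
      (fun z => iteratedDeriv i f w / (i.factorial : ℂ) * (z - w) ^ ((i : ℤ) - (n + 1 : ℕ)))
      (sphere c R) := by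
    intro i _
    exact continuousOn_const.mul ((continuousOn_id.sub continuousOn_const).zpow₀ _
      fun z hz => Or.inl (hsph z hz))
  have hint_pow : ∀ i ∈ Finset.range (n + 1), CircleIntegrable
      (fun z => iteratedDeriv i f w / (i.factorial : ℂ) * (z - w) ^ ((i : ℤ) - (n + 1 : ℕ))) c R :=
    fun i hi => (hcont_pow i hi).circleIntegrable hR0.le
  have hint_sum : CircleIntegrable (fun z => ∑ i ∈ Finset.range (n + 1),
      iteratedDeriv i f w / (i.factorial : ℂ) * (z - w) ^ ((i : ℤ) - (n + 1 : ℕ))) c R :=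
    (continuousOn_finsetSum _ hcont_pow).circleIntegrable hR0.le
  have hint_g : CircleIntegrable g₁ c R :=
    (hg₁c.continuousOn_ball.mono sphere_subset_closedBall).circleIntegrable hR0.le
  rw [circleIntegral.integral_add hint_sum hint_g, hg₁c.circleIntegral_eq_zero hR0.le, add_zero,
    circleIntegral.integral_fun_sum hint_pow]
  simp only [circleIntegral.integral_const_mul]
  rw [Finset.sum_eq_single_of_mem n (Finset.mem_range.mpr (Nat.lt_succ_self n))]
  · have : ((n : ℤ) - (n + 1 : ℕ)) = -1 := by push_cast; ring
    rw [this]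
    simp only [zpow_neg_one]
    rw [circleIntegral.integral_sub_inv_of_mem_ball hw]
    ring
  · intro i hi hne
    have hi' : i < n := lt_of_le_of_ne (Nat.lt_succ_iff.mp (Finset.mem_range.mp hi)) hne
    have : ((i : ℤ) - (n + 1 : ℕ)) ≠ -1 := by
      push_cast
      omega
    rw [circleIntegral.integral_sub_zpow_of_ne this, mul_zero]


end Literature.Analysis.Complex

end
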